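import Literature.MathematicalPhysics.QuantumFieldTheory.Balaban1983to89.T3AlphaInputsACTwoRunLevel
import Summits.QuantumFields.YangMills.Theorems.UnitScaleTiltFluctuationComparisonRegPrTwoRunGeometry

/-!
# Crux idea seat `ym-cruxidea-19201-1` (ideator 1 of 2, lens: transfer), gen 4 — SKETCH for card 5 `e1-second-order-kantorovich`

Crux of record: stmt-QuantumFields-19201 `FluctuationComparisonRegPr` (aside) ∕ live twin stmt-QuantumFields-19935 `FluctuationComparisonRegPrL`,
registered line `Cruxes/FluctuationComparisonRegPrL/Lines/birth_v5h.lean` STUB 3′ `stub_alphaTwoRunOfLane`, row `PolymerCauchyMinAt` of `TwoRunMin`.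

THE POINT.  The route-level minimiser two-cut-off closeness e1 = `T3AlphaInputsACTwoRun.MinimiserCauchyAt F γ ε₀ b₀ p₀ a₁` (bond-level gauge-orbit
sup-distance of `coarsenField U′` and `U` at most `C·θ(n)·L^{−2k}·L^{−a₁k}`, `k = K − n`) was retired by the lead's FINDING-19201-e1-scaling because PRINT's only
two-cut-off rate for minimiser∕interpolation operators is [King1986] Prop. 3.8 (3.71), `L^{−γk}` with `γ + α < 1` (p.673) — one factor `Lᵏ` short.  That
ceiling is King's Hölder bookkeeping of GAUSSIAN interpolation operators, not a property of the object: the two-grid defect of the block-average-constrained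
minimiser is a deterministic elliptic CONSISTENCY error, even in the lattice spacing for a reflection-equivariant scheme (Wilson action; (0.4) averaging
with axis-ordered contours from the block CENTRE, odd `L`), hence of relative order `γ_det = 2` (minus logs from the unit-scale roughness of `V`), and
`a₁ = γ_det − 1 = 1⁻ > 0`.  Mechanism (FEM dictionary: Strang's first lemma + Newton–Kantorovich + discrete-Green's-function sup-norm bound):
  K1 `LiftNearCriticalAt`  — the run-`K` regular minimiser lifts EXACTLY into run-`(K+1)`'s regular fibre (19200's `SmoothLiftAt` witness) with an
      Euler–Lagrange residual of relative order `L^{−(1+a₁)k}` in the derivative-free ℓ¹–ℓ^∞ pairing `NearCriticalOn` (second-order consistency);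
  K2 `KantorovichAt`       — ONE RUN: on print's regular fibre a near-critical configuration is within gauge-orbit sup-distance `C_G·L^{2k′}·ρ` of the
      minimiser (`‖G_{k′}‖_{∞→∞} ≍ L^{2k′}` = [Balaban1985RegularSpaces] (1.33) Green's functions, + uniqueness [Balaban1985Variational] Thm 1);
  K3 `CoarsenLipschitzAt`  — one (0.4) averaging step is Lipschitz modulo gauge ([Balaban1985Averaging] (8)).
  §4 `minimiserCauchyAt_of_kantorovich` : K1 → K2 → K3 → (residual inside Kantorovich's basin) → MinimiserCauchyAt F γ ε₀ b₀ p₀ a₁   — PROVED.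
With e1 back, the LANDED unfolded composition `Summit.….LogComparisonLevelCauchyTriv.cauchyAtHeights_of_trivRows` (TwoRunLv rows at the CANONICAL matched
background `coarsenField U′` + e1 ⇒ `CauchyAtHeights`) is a live alternative to the folded row, and card C4's kill-test (iv) `a ≤ a₁` is met (`a < 1 ≤ a₁`).

TOY (census, `toy/toy_e1_twogrid.py`, pure python, exact Fourier solution; scalar∕abelian linearisation, torus of `n_b` unit blocks, iid Gaussian block data,
`δ_k := C u_{k+1} − u_k`, `g_k := log_L(sup|δ_{k−1}|∕sup|δ_k|)` → γ_det):
  d=1 L=2 n_b=4 plain:  g_k = 0.72 1.49 1.78 1.90 1.95 1.98 1.99 (k=2..8);  smear1: … 1.98 1.99 2.00;  L=3: 1.42 1.75 1.93 1.98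
  d=2 L=2 n_b=4 plain:  g_k = 0.02 1.46 1.74 1.82 1.91 1.95 (k=2..7);       smear1 (k≤6): … 1.67 1.86 1.93;  n_b=2: … 1.83 1.91 1.90
  d=3 L=2 n_b=2 plain:  g_k = 1.22 1.75 1.83 (k=3..5);                       smear1 (k≤4): 1.17 1.66;  n_b=4 (k≤3): 1.35
  ⇒ γ_det → 2 from below in every dimension (same trajectory in d = 2 and d = 3); relative to the bond-natural size the defect is `L^{−2k}`: a₁ = 1.
  Gradient level (curvature analogue): plain g_k(grad) → 2 as well (defect lives in lattice-scale dipole layers at block faces), i.e. relative `L^{−k}` only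
  at the curvature scale — irrelevant for e1, which is typed at bond level (`orbitDistOn`).
WHAT THIS IS NOT: no estimate of Bałaban's is asserted; K1–K3 are hypothesis schemas (never asserted); the only proof is the composition §4 (real arithmetic).
Seat folder only; never landed.  Farm check: see STATUS line.

References: T. Bałaban, CMP 102 (1985) 277–309 [Balaban1985Variational] Thm 1 (8)–(10) p.279; CMP 99 (1985) 75–102 [Balaban1985RegularSpaces] (1.33);
CMP 98 (1985) 17–51 [Balaban1985Averaging] (8) p.19; C. King, CMP 102 (1986) 649–677 [King1986] Prop. 3.8 (3.71) p.664, p.673; A. Ern, J.-L. Guermond,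
Theory and Practice of Finite Elements (2004) Lemma 2.25 (Strang 2) p.117, Lemma 2.27 (Strang 1) p.118; S. Christiansen, T. Halvorsen, arXiv:1006.2059 p.10
(consistency of order h² of the lattice gauge action).
-/

noncomputable section

open Literature.MathematicalPhysics.QuantumFieldTheory.Balaban1983to89
open Literature.MathematicalPhysics.QuantumFieldTheory.Balaban1983to89.T3ContinuumYM3Torus
open Literature.MathematicalPhysics.QuantumFieldTheory.Balaban1983to89.T3LevelShift
open Literature.MathematicalPhysics.QuantumFieldTheory.Balaban1983to89.T3UnitLawDensityEML (ℰp)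
open Literature.MathematicalPhysics.QuantumFieldTheory.Balaban1983to89.T3UnitScaleTilt
open Literature.MathematicalPhysics.QuantumFieldTheory.Balaban1983to89.T3TiltDescent
open Literature.MathematicalPhysics.QuantumFieldTheory.Balaban1983to89.T3ConstrainedMinimiser
open Literature.MathematicalPhysics.QuantumFieldTheory.Balaban1983to89.T3RegularMinimiser
open Literature.MathematicalPhysics.QuantumFieldTheory.Balaban1983to89.T3PrintedRegularMinimiser
open Literature.MathematicalPhysics.QuantumFieldTheory.Balaban1983to89.T3AlphaInputsACTwoRun
open Literature.MathematicalPhysics.QuantumFieldTheory.Balaban1983to89.T3AlphaInputsACTwoRunLevel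
open Summit.QuantumFields.YangMills.Theorems.LogComparisonTwoRunGeometry (coarsenField_eq_descendTo)

namespace Summit.QuantumFields.YangMills.Cruxes.FluctuationComparisonRegPr.Ideate1Kantorovich

variable (F : T3Family)

/-! ## §1 Derivative-free near-criticality (the ℓ¹–ℓ^∞ pairing form of «the constrained Euler–Lagrange residual has sup-norm ≤ ρ») -/

/-- **NEAR-CRITICALITY ON A SET, DERIVATIVE-FREE**: `U″` is `(ρ, M)`-near-critical for the Wilson action on `S` when no competitor `W ∈ S` lowers the
action by more than `ρ·‖W − U″‖_{ℓ¹(bonds)} + M·‖W − U″‖²_{ℓ²(bonds)}` (group distance per bond).  For a `C²` functional this is `‖∇_S A(U″)‖_{ℓ^∞} ≤ ρ`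
with `M` a Hessian bound; typed without derivatives so that it elaborates over the tree's `GaugeField = PBond → G`. [folklore] -/
def NearCriticalOn {K' : ℕ} (S : Set (GaugeField (F.P K') 0 (Matrix.specialUnitaryGroup (Fin 2) ℂ))) (ρ M : ℝ)
    (U'' : GaugeField (F.P K') 0 (Matrix.specialUnitaryGroup (Fin 2) ℂ)) : Prop :=
  ∀ W ∈ S, wilsonAction4 U'' - wilsonAction4 W ≤
    ρ * (∑ b : PBond (F.P K') 0, GaugeGroup.dist1 (U'' b * (W b)⁻¹)) +
      M * ∑ b : PBond (F.P K') 0, GaugeGroup.dist1 (U'' b * (W b)⁻¹) ^ 2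

/-! ## §2 The three schemas (hypotheses, never asserted) -/

/-- **K1 — SECOND-ORDER CONSISTENCY OF THE EXACT LIFT (crux, rank 2)**: every minimiser `U` of the Wilson action over print's regular fibre (6)(ε₀) of a
`θ(n)`-small datum `V` in run `K` has an EXACT lift `U″` into run `(K+1)`'s regular fibre of the same `V` (`D_{K,K+1}U″ = U`; 19200's `SmoothLiftAt`
witness) which is near-critical there with residual `ρ = C₁·θ(n)·L^{−2(k+1)}·L^{−(2+a₁)k}`, `k = K − n` — i.e. `L^{−(1+a₁)k}·L^{−2}` relative to the natural
Euler–Lagrange scale `θ(n)L^{−3k}`; `a₁ = 1` is second-order consistency (even expansion in the spacing: Wilson action and (0.4) averaging with axis-ordered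
contours from the block centre are reflection-equivariant for odd `L`).  UNPRINTED; classical numerical analysis of the lattice Yang–Mills equation
(consistency of order h²: Christiansen–Halvorsen).  Why it might fail: unit-scale roughness of `V` (Lagrange multipliers jump across block faces) costs
logarithms — toy says γ_det → 2 from below, any `a₁ < 1` is safe. [cite: Balaban1985Variational, Thm 1 (8)-(10) p.279] -/
def LiftNearCriticalAt (γ ε₀ b₀ p₀ a₁ C₁ M : ℝ) : Prop :=
  ∀ (K n : ℕ) (h : n ≤ K) (V : GaugeField (F.P n) 0 (Matrix.specialUnitaryGroup (Fin 2) ℂ)),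
    PlaqSmall (θBal F.L γ b₀ p₀ n) V →
      ∀ U ∈ regFibrePr F n K h ε₀ V, wilsonAction4 U = minActionRegPr F n K h ε₀ V →
        ∃ U'' ∈ regFibrePr F n (K + 1) (h.trans (Nat.le_succ K)) ε₀ V,
          descendTo F ℰp K (K + 1) (Nat.le_succ K) U'' = U ∧
          NearCriticalOn F (regFibrePr F n (K + 1) (h.trans (Nat.le_succ K)) ε₀ V)
            (C₁ * θBal F.L γ b₀ p₀ n * (((F.L : ℝ) ^ (K + 1 - n)) ^ 2)⁻¹ *
              ((((F.L : ℝ) ^ (K - n))⁻¹) ^ 2 * (((F.L : ℝ) ^ (K - n))⁻¹) ^ a₁)) M U''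

/-- **K2 — ℓ^∞ NEWTON–KANTOROVICH ON ONE RUN'S REGULAR FIBRE (crux, rank 3)**: in ONE cut-off `K′`, at height `n`, for a `θ(n)`-small datum `V`: every
`(ρ, M)`-near-critical configuration `U″` of print's regular fibre (6)(ε₀) with residual inside the basin, `ρ ≤ ρ₀·L^{−3(K′−n)}`, is within gauge-orbit
sup-distance `C_G·L^{2(K′−n)}·ρ` of EVERY minimiser `U′` over that fibre — `L^{2k′}` = the ℓ^∞→ℓ^∞ norm of the constrained background propagator
`G_{k′}` (decay on the block scale), the minimiser being print's unique critical orbit.  Printed IN KIND for one run: the Green's functions bounds and the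
analytic expansion of `U_k(V)`; never needs a second cut-off.  Why it might fail: the Hessian's gauge zero-modes on the constrained space need print's gauge
fixing (Thm 2 of CMP 99) to be uniform in the window. [cite: Balaban1985Variational, Thm 1 (8) p.279] -/
def KantorovichAt (γ ε₀ b₀ p₀ ρ₀ M C_G : ℝ) : Prop :=
  ∀ (K' n : ℕ) (h : n ≤ K') (V : GaugeField (F.P n) 0 (Matrix.specialUnitaryGroup (Fin 2) ℂ)),
    PlaqSmall (θBal F.L γ b₀ p₀ n) V →
      ∀ ρ : ℝ, 0 ≤ ρ → ρ ≤ ρ₀ * (((F.L : ℝ) ^ (K' - n))⁻¹) ^ 3 →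
        ∀ U'' ∈ regFibrePr F n K' h ε₀ V, NearCriticalOn F (regFibrePr F n K' h ε₀ V) ρ M U'' →
          ∀ U' ∈ regFibrePr F n K' h ε₀ V, wilsonAction4 U' = minActionRegPr F n K' h ε₀ V →
            orbitDistOn F Set.univ U' U'' ≤ C_G * ((F.L : ℝ) ^ (K' - n)) ^ 2 * ρ

/-- **K3 — ONE AVERAGING STEP IS LIPSCHITZ MODULO GAUGE (support)**: the (0.4) average read on run `K`'s lattice (`coarsenField`) contracts the global
gauge-orbit sup-distance up to a constant `C_A` (≍ (d+1)L: each coarse bond variable is an exp-mean-log of products of O(L) fine bond variables, and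
averaging is gauge-covariant).  Printed in kind. [cite: Balaban1985Averaging, (8) p.19] -/
def CoarsenLipschitzAt (C_A : ℝ) : Prop :=
  ∀ (K : ℕ) (U' U'' : GaugeField (F.P (K + 1)) 0 (Matrix.specialUnitaryGroup (Fin 2) ℂ)),
    orbitDistOn F Set.univ (coarsenField F K U') (coarsenField F K U'') ≤ C_A * orbitDistOn F Set.univ U' U''

/-! ## §3 The basin guard (the lift's residual lies in Kantorovich's basin: holds for `γ ≤ γ₁(C₁, ρ₀)` since `θ(n) → 0`) -/

/-- **THE GUARD**, in exactly the shape §4 consumes. [folklore] -/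
def BasinGuard (γ b₀ p₀ a₁ C₁ ρ₀ : ℝ) : Prop :=
  ∀ (K n : ℕ), n ≤ K →
    C₁ * θBal F.L γ b₀ p₀ n * (((F.L : ℝ) ^ (K + 1 - n)) ^ 2)⁻¹ *
        ((((F.L : ℝ) ^ (K - n))⁻¹) ^ 2 * (((F.L : ℝ) ^ (K - n))⁻¹) ^ a₁) ≤
      ρ₀ * (((F.L : ℝ) ^ (K + 1 - n))⁻¹) ^ 3

/-- **THE GUARD FROM A THRESHOLD**: `0 ≤ a₁`, `0 ≤ C₁` and `C₁·L·θ(n) ≤ ρ₀` for all `n` give `BasinGuard` (`L^{k+1}·L^{−(2+a₁)k} ≤ L`). [folklore] -/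
theorem basinGuard_of_threshold {γ b₀ p₀ a₁ C₁ ρ₀ : ℝ} (ha₁ : 0 ≤ a₁) (hC₁ : 0 ≤ C₁)
    (hθ0 : ∀ n, 0 ≤ θBal F.L γ b₀ p₀ n) (hθ : ∀ n, C₁ * F.L * θBal F.L γ b₀ p₀ n ≤ ρ₀) :
    BasinGuard F γ b₀ p₀ a₁ C₁ ρ₀ := by
  intro K n hn
  have hL1 : (1 : ℝ) ≤ F.L := by exact_mod_cast F.hL.2.le
  have hL : (0 : ℝ) < F.L := lt_of_lt_of_le one_pos hL1
  set P : ℝ := (F.L : ℝ) ^ (K + 1 - n) with hP_def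
  set x : ℝ := ((F.L : ℝ) ^ (K - n))⁻¹ with hx_def
  have hP : 0 < P := pow_pos hL _
  have hx : 0 < x := inv_pos.mpr (pow_pos hL _)
  have hx1 : x ≤ 1 := inv_le_one_of_one_le₀ (one_le_pow₀ hL1)
  have hxa : x ^ a₁ ≤ 1 := Real.rpow_le_one hx.le hx1 ha₁
  have hxa0 : 0 ≤ x ^ a₁ := Real.rpow_nonneg hx.le a₁
  -- `P = L · L^{K-n}` and `P · x = L`
  have hPx : P * x = F.L := by
    rw [hP_def, hx_def, show K + 1 - n = (K - n) + 1 by omega, pow_succ]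
    field_simp
  -- the claim is `C₁ θ P⁻² x² xᵃ ≤ ρ₀ P⁻³`, i.e. `C₁ θ (P x) · x · xᵃ ≤ ρ₀`
  have key : C₁ * θBal F.L γ b₀ p₀ n * (P * x) * (x * x ^ a₁) ≤ ρ₀ := by
    rw [hPx]
    have h1 : x * x ^ a₁ ≤ 1 := by
      calc x * x ^ a₁ ≤ 1 * 1 := mul_le_mul hx1 hxa hxa0 zero_le_one
        _ = 1 := one_mul 1
    have h0 : 0 ≤ C₁ * F.L * θBal F.L γ b₀ p₀ n := by
      have := hθ0 n; positivity
    calc C₁ * θBal F.L γ b₀ p₀ n * F.L * (x * x ^ a₁)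
        = (C₁ * F.L * θBal F.L γ b₀ p₀ n) * (x * x ^ a₁) := by ring
      _ ≤ (C₁ * F.L * θBal F.L γ b₀ p₀ n) * 1 := mul_le_mul_of_nonneg_left h1 h0
      _ ≤ ρ₀ := by rw [mul_one]; exact hθ n
  have hP3 : (0 : ℝ) < (P⁻¹) ^ 3 := by positivity
  -- multiply `key` by `P⁻³ > 0`
  have := mul_le_mul_of_nonneg_right key hP3.le
  calc C₁ * θBal F.L γ b₀ p₀ n * (P ^ 2)⁻¹ * (x ^ 2 * x ^ a₁)
      = C₁ * θBal F.L γ b₀ p₀ n * (P * x) * (x * x ^ a₁) * (P⁻¹) ^ 3 := by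
        field_simp
    _ ≤ ρ₀ * (P⁻¹) ^ 3 := this

/-! ## §4 The composition: e1 from K1–K3 (PROVED) -/

/-- **e1 BY NEWTON–KANTOROVICH AT THE LIFTED COARSE MINIMISER** (PROVED composition): `LiftNearCriticalAt` (K1) ∧ `KantorovichAt` (K2, run `K+1` only) ∧
`CoarsenLipschitzAt` (K3) ∧ the basin guard ⇒ `MinimiserCauchyAt F γ ε₀ b₀ p₀ a₁` with constant `C_A·C_G·C₁`:
`dist(coarsen U′, U) = dist(coarsen U′, coarsen U″) ≤ C_A·dist(U′, U″) ≤ C_A·C_G·L^{2(k+1)}·ρ = C_A C_G C₁·θ(n)·L^{−2k}·L^{−a₁k}`.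
No comparison of two runs' operators, propagators or kernels occurs: the only two-run input is K1's consistency residual. [cite: Balaban1985Variational, Thm 1 (8)-(10) p.279] -/
theorem minimiserCauchyAt_of_kantorovich {γ ε₀ b₀ p₀ a₁ C₁ M ρ₀ C_G C_A : ℝ} (hC₁ : 0 ≤ C₁) (hC_A : 0 ≤ C_A)
    (hθ0 : ∀ n, 0 ≤ θBal F.L γ b₀ p₀ n) (hguard : BasinGuard F γ b₀ p₀ a₁ C₁ ρ₀)
    (h1 : LiftNearCriticalAt F γ ε₀ b₀ p₀ a₁ C₁ M) (h2 : KantorovichAt F γ ε₀ b₀ p₀ ρ₀ M C_G) (h3 : CoarsenLipschitzAt F C_A) :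
    MinimiserCauchyAt F γ ε₀ b₀ p₀ a₁ := by
  refine ⟨C_A * C_G * C₁, fun K n h V hV U hU hUmin U' hU' hU'min => ?_⟩
  have hL : (0 : ℝ) < F.L := by exact_mod_cast lt_trans zero_lt_one F.hL.2
  obtain ⟨U'', hU''mem, hdesc, hnc⟩ := h1 K n h V hV U hU hUmin
  set ρ : ℝ := C₁ * θBal F.L γ b₀ p₀ n * (((F.L : ℝ) ^ (K + 1 - n)) ^ 2)⁻¹ *
    ((((F.L : ℝ) ^ (K - n))⁻¹) ^ 2 * (((F.L : ℝ) ^ (K - n))⁻¹) ^ a₁) with hρ_def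
  have hρ0 : 0 ≤ ρ := by
    have := hθ0 n
    have hxa : 0 ≤ (((F.L : ℝ) ^ (K - n))⁻¹) ^ a₁ := Real.rpow_nonneg (by positivity) a₁
    positivity
  have hk : orbitDistOn F Set.univ U' U'' ≤ C_G * ((F.L : ℝ) ^ (K + 1 - n)) ^ 2 * ρ :=
    h2 (K + 1) n (h.trans (Nat.le_succ K)) V hV ρ hρ0 (hguard K n h) U'' hU''mem hnc U' hU' hU'min
  have hU_eq : coarsenField F K U'' = U := by rw [coarsenField_eq_descendTo]; exact hdesc
  have hc := h3 K U' U''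
  rw [hU_eq] at hc
  have hP : (((F.L : ℝ) ^ (K + 1 - n)) ^ 2) ≠ 0 := pow_ne_zero _ (pow_ne_zero _ hL.ne')
  calc orbitDistOn F Set.univ (coarsenField F K U') U
      ≤ C_A * orbitDistOn F Set.univ U' U'' := hc
    _ ≤ C_A * (C_G * ((F.L : ℝ) ^ (K + 1 - n)) ^ 2 * ρ) := mul_le_mul_of_nonneg_left hk hC_A
    _ = C_A * C_G * C₁ * θBal F.L γ b₀ p₀ n * (((F.L : ℝ) ^ (K - n))⁻¹) ^ 2 * (((F.L : ℝ) ^ (K - n))⁻¹) ^ a₁ := by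
        rw [hρ_def]
        field_simp

/-! ## §5 Where it plugs in (no new statement): with e1, the landed `Summit.QuantumFields.YangMills.Theorems.LogComparisonLevelCauchyTriv.cauchyAtHeights_of_trivRows`
(TwoRunLv rows at the canonical matched background + `MinimiserCauchyAt` ⇒ `CauchyAtHeights`) is the unfolded alternative to v5h's folded row. -/

end Summit.QuantumFields.YangMills.Cruxes.FluctuationComparisonRegPr.Ideate1Kantorovich

end
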